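import Literature.AnabelianGeometry.SemiGraphs.CoverticialRemark241CoveringProofs
import Literature.AnabelianGeometry.SemiGraphs.HomComposition
import HarnessLib

/-!
# [SemiAnbd] Remark 2.4.1 along finite étale coverings: the universally sub-coverticial clause (c2)
# from the stability of print's coverings under composition — PROOFS

Mochizuki, *Semi-graphs of anabelioids*, Publ. RIMS **42** (2006) 221–322, §2, Remark 2.4.1, author's
manuscript p. 26 [cite: MochizukiSemiAnbd2006, Rem. 2.4.1 p.26]: "one verifies easily that if `𝒢' → 𝒢`
is a finite étale covering, and … `e'` … is a(n) … edge of `𝒢'` that maps to a(n) … universally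
sub-coverticial edge `e` … of `𝒢`, then … `e'` … is itself … universally sub-coverticial".

PROOF-ONLY companion (abc-iut cell, F wave, FACT-LIST row F-1478, seat abc-iut-f-161): no definition,
no new named fact; `Coverticial.lean` (statement owner abc-iut-L3-t1) is imported, never edited.

The tree reduces the named fact `SemiGraphOfAnabelioids.remark_2_4_1_covering` to its clause c2 alone
(`remark_2_4_1_covering_of_universallySubCoverticial`, `CoverticialRemark241CoveringProofs.lean`: the
elevated / aloof / estranged clauses are kernel theorems).  Print's "easy verification" of c2 is the
observation that finite étale coverings COMPOSE: for a finite étale covering `ψ : 𝒢'' → 𝒢'` and an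
edge `e''` over `e'`, the composite `𝒢'' → 𝒢' → 𝒢` is a finite étale covering of `𝒢` along which
`e''` lies over `e`, so `e''` is sub-coverticial by the universal sub-coverticiality of `e`
(sub-coverticiality of `e''` being a property of `𝒢''` and `e''` alone, Def. 2.4 (iii)).  This file
makes that reduction kernel-exact:

* `isUniversallySubCoverticial_of_exists_covering_over_comp` — c2 for ONE covering `φ : 𝒢' → 𝒢`,
  from: every finite étale covering `ψ : 𝒢'' → 𝒢'` (print's sense, `Hom.IsFiniteEtaleCoveringGlobal`
  = local ∧ global ∧ branch-aligned ∧ vertex-aligned) admits SOME finite étale covering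
  `χ : 𝒢'' → 𝒢` over the composite `ψ.base ≫ φ.base` of the underlying morphisms of semi-graphs;
* `isUniversallySubCoverticial_of_comp` — in particular from the stability of
  `Hom.IsFiniteEtaleCoveringGlobal` under the composition `Hom.comp` of `HomComposition.lean`
  (abc-iut-L3 merge step M3b), taking `χ := ψ.comp φ`;
* `remark_2_4_1_covering_of_comp_isFiniteEtaleCoveringGlobal` /
  `remark_2_4_1_covering_of_exists_covering_over_comp` — hence the named fact F-1478 from that single
  closure property (resp. its `∃`-weakening), stated verbatim as a hypothesis.

Honest framing: typed ≠ proved — the closure of print's covering notion under `Hom.comp` (all four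
clauses) is NOT in the tree at the time of writing; it is exactly the residual of F-1478 (the 2-cells
`φ_b` are data, and the local / global / alignment clauses of a composite have to be assembled from
those of the factors).  Nothing here takes a side on [IUTchIII] Cor. 3.12.
-/

namespace Literature.AnabelianGeometry.SemiGraphs

open CategoryTheory

universe v₁ u₁ u

namespace SemiGraphOfAnabelioids

variable {𝒢 𝒢' 𝒢'' : SemiGraphOfAnabelioids.{v₁, u₁, u}}

/-! ### Bookkeeping: edges along a composite -/

/-- The underlying edge map of a composite `ψ.comp φ : 𝒢'' → 𝒢` is the composite of the edge maps.
[cite: MochizukiSemiAnbd2006, Rem. 2.4.2 p.26] -/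
theorem Hom.comp_base_edgeMap (ψ : Hom 𝒢'' 𝒢') (φ : Hom 𝒢' 𝒢) (e'' : 𝒢''.graph.Edge) :
    (ψ.comp φ).base.edgeMap e'' = φ.base.edgeMap (ψ.base.edgeMap e'') := rfl

/-- The underlying vertex map of a composite `ψ.comp φ : 𝒢'' → 𝒢` is the composite of the vertex
maps. [cite: MochizukiSemiAnbd2006, Rem. 2.4.2 p.26] -/
theorem Hom.comp_base_vertexMap (ψ : Hom 𝒢'' 𝒢') (φ : Hom 𝒢' 𝒢) (v'' : 𝒢''.graph.Vertex) :
    (ψ.comp φ).base.vertexMap v'' = φ.base.vertexMap (ψ.base.vertexMap v'') := rfl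

/-! ### Clause c2 from coverings over the composite -/

/-- **[SemiAnbd] Remark 2.4.1, universally sub-coverticial clause (c2), from coverings over
composites.**  Let `φ : 𝒢' → 𝒢` be a finite étale covering (print's sense) such that every finite
étale covering `ψ : 𝒢'' → 𝒢'` admits a finite étale covering `χ : 𝒢'' → 𝒢` whose underlying morphism
of semi-graphs is the composite `ψ.base ≫ φ.base` (print: "the composite is a finite étale
covering").  Then an edge `e'` of `𝒢'` over a universally sub-coverticial edge of `𝒢` is universally
sub-coverticial: it is closed (proper base), and an edge `e''` of a covering `𝒢''` of `𝒢'` over `e'`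
lies, along `χ`, over `φ e'`, whence it is sub-coverticial in `𝒢''`.
[cite: MochizukiSemiAnbd2006, Rem. 2.4.1 p.26] -/
theorem isUniversallySubCoverticial_of_exists_covering_over_comp {φ : Hom 𝒢' 𝒢}
    (hφ : φ.IsFiniteEtaleCoveringGlobal)
    (hcomp : ∀ (𝒢'' : SemiGraphOfAnabelioids.{v₁, u₁, u}) (ψ : Hom 𝒢'' 𝒢'),
      ψ.IsFiniteEtaleCoveringGlobal →
        ∃ χ : Hom 𝒢'' 𝒢, χ.IsFiniteEtaleCoveringGlobal ∧ χ.base = ψ.base ≫ φ.base)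
    (e' : 𝒢'.graph.Edge) (h : 𝒢.IsUniversallySubCoverticial (φ.base.edgeMap e')) :
    𝒢'.IsUniversallySubCoverticial e' := by
  refine ⟨hφ.isClosedEdge e' h.1, fun 𝒢'' ψ hψ e'' he'' => ?_⟩
  obtain ⟨χ, hχ, hbase⟩ := hcomp 𝒢'' ψ hψ
  refine h.2 𝒢'' χ hχ e'' ?_
  rw [hbase, SemiGraph.comp_edgeMap, Function.comp_apply, he'']

/-- **[SemiAnbd] Remark 2.4.1, clause (c2), from the stability of finite étale coverings under
composition**: if for every finite étale covering `ψ : 𝒢'' → 𝒢'` the composite `ψ.comp φ : 𝒢'' → 𝒢`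
(`HomComposition.lean`) is again a finite étale covering, then edges of `𝒢'` over universally
sub-coverticial edges of `𝒢` are universally sub-coverticial.
[cite: MochizukiSemiAnbd2006, Rem. 2.4.1 p.26] -/
theorem isUniversallySubCoverticial_of_comp {φ : Hom 𝒢' 𝒢} (hφ : φ.IsFiniteEtaleCoveringGlobal)
    (hcomp : ∀ (𝒢'' : SemiGraphOfAnabelioids.{v₁, u₁, u}) (ψ : Hom 𝒢'' 𝒢'),
      ψ.IsFiniteEtaleCoveringGlobal → (ψ.comp φ).IsFiniteEtaleCoveringGlobal)
    (e' : 𝒢'.graph.Edge) (h : 𝒢.IsUniversallySubCoverticial (φ.base.edgeMap e')) :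
    𝒢'.IsUniversallySubCoverticial e' :=
  isUniversallySubCoverticial_of_exists_covering_over_comp hφ
    (fun 𝒢'' ψ hψ => ⟨ψ.comp φ, hcomp 𝒢'' ψ hψ, Hom.comp_base ψ φ⟩) e' h

/-! ### Assembly: the named fact F-1478 from the closure of coverings under composition -/

/-- **[SemiAnbd] Remark 2.4.1 (second sentence) along finite étale coverings — the named fact
`remark_2_4_1_covering` (FACT-LIST F-1478) from ONE closure property**: if print's finite étale
coverings (`Hom.IsFiniteEtaleCoveringGlobal`) are stable under the composition `Hom.comp` of
1-morphisms of semi-graphs of anabelioids, then `remark_2_4_1_covering` holds (clauses c1, c3, c4 are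
the kernel theorems of `CoverticialRemark241CoveringProofs.lean`; c2 is
`isUniversallySubCoverticial_of_comp`).  The closure property is stated verbatim as the hypothesis;
no new `Prop` is named. [cite: MochizukiSemiAnbd2006, Rem. 2.4.1 p.26] -/
theorem remark_2_4_1_covering_of_comp_isFiniteEtaleCoveringGlobal
    (hcomp : ∀ (𝒢 𝒢' 𝒢'' : SemiGraphOfAnabelioids.{v₁, u₁, u}) (ψ : Hom 𝒢'' 𝒢') (φ : Hom 𝒢' 𝒢),
      ψ.IsFiniteEtaleCoveringGlobal → φ.IsFiniteEtaleCoveringGlobal →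
        (ψ.comp φ).IsFiniteEtaleCoveringGlobal) :
    Literature.AnabelianGeometry.SemiGraphs.SemiGraphOfAnabelioids.remark_2_4_1_covering.{v₁, u₁, u} :=
  remark_2_4_1_covering_of_universallySubCoverticial fun 𝒢 𝒢' φ hφ e' he =>
    isUniversallySubCoverticial_of_comp hφ (fun 𝒢'' ψ hψ => hcomp 𝒢 𝒢' 𝒢'' ψ φ hψ hφ) e' he

/-- **The named fact F-1478 from the `∃`-form of the closure property**: it suffices that for every
pair of finite étale coverings `ψ : 𝒢'' → 𝒢'`, `φ : 𝒢' → 𝒢` there is SOME finite étale covering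
`𝒢'' → 𝒢` over the composite morphism of underlying semi-graphs (e.g. any 1-morphism 2-isomorphic to
`ψ.comp φ`). [cite: MochizukiSemiAnbd2006, Rem. 2.4.1 p.26] -/
theorem remark_2_4_1_covering_of_exists_covering_over_comp
    (hcomp : ∀ (𝒢 𝒢' 𝒢'' : SemiGraphOfAnabelioids.{v₁, u₁, u}) (ψ : Hom 𝒢'' 𝒢') (φ : Hom 𝒢' 𝒢),
      ψ.IsFiniteEtaleCoveringGlobal → φ.IsFiniteEtaleCoveringGlobal →
        ∃ χ : Hom 𝒢'' 𝒢, χ.IsFiniteEtaleCoveringGlobal ∧ χ.base = ψ.base ≫ φ.base) :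
    Literature.AnabelianGeometry.SemiGraphs.SemiGraphOfAnabelioids.remark_2_4_1_covering.{v₁, u₁, u} :=
  remark_2_4_1_covering_of_universallySubCoverticial fun 𝒢 𝒢' φ hφ e' he =>
    isUniversallySubCoverticial_of_exists_covering_over_comp hφ
      (fun 𝒢'' ψ hψ => hcomp 𝒢 𝒢' 𝒢'' ψ φ hψ hφ) e' he

end SemiGraphOfAnabelioids

end Literature.AnabelianGeometry.SemiGraphs
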